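import Summits.QuantumFields.BalabanUV.T4Continuum.Support.VariationalCovariantUpperBound
import Summits.QuantumFields.BalabanUV.T4Continuum.Support.ScalarBlockTrialFunction

/-!
# T⁴ programme, spine node NE2 (U1a), lane P2 — SUPPORT: TAXI CONTOUR TRANSPORTS (U(1)) — the in-block one-bond transport defect of the
# leaves UB⁺ / ONE⁺ DERIVED from the plaquette defect alone, for site transports along taxi contours from the block base point

NE2 formalisation swarm `b2b-balaban-t4-ne2-formalise-*`, leaf 04 GEN 2 (`prover-b2b-balaban-t4-ne2-formalise-leaf-04-g2-0`); journal INTENT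
CLAIMS.log l.9212.  The P2 (variational) leaves treat the site transports `T` as DATA and display a one-bond IN-BLOCK transport defect:
`VariationalCovariantUpperBound` (UB⁺, p212172) binder `hw`, and `VariationalCovariantInterpolant` (ONE⁺, leaf-01-g2) binder `hin` — both
literally `∀ y j μ, j_μ + 1 < L → ‖R(L·y+j, μ)·conj T(L·y+j+e_μ)·T(L·y+j) − 1‖ ≤ w`.  For Bałaban-type data `T` is NOT free: it is the
transport of `R` along a contour from the block base point ([Balaban1985BackgroundPropagators] (3.19) p.393 «R(U(Γ_{y,x}))», SHAPE; here
abelian, taxi contours).  This file DEFINES the taxi transport from the bond phases and proves that binder from the PLAQUETTE DEFECT alone.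

THE OBJECTS ([folklore]; fine torus `Tor (fine L N)`, blocks over `Tor N`; `R : Tor (fine L N) → Fin d → ℂ` with `|R| = 1`).
 * `plaq R x μ ν := R(x,μ)·R(x+e_μ,ν)·conj R(x+e_ν,μ)·conj R(x,ν)` — the plaquette holonomy; hypothesis `‖plaq − 1‖ ≤ a` (for a smooth
   background of field strength `α` at fine spacing `(nL)⁻¹`: `a ≍ α·(nL)⁻²`);
 * `corner R? y j i := bpt L N y (j_κ for κ < i, 0 else)` — the corner of the taxi path after the legs in directions `< i`;
 * `leg R y j i := piT R (corner y j i) i (j_i)` (FED⁺'s straight transporter `VariationalCovariantFederbush.piT` BY NAME) and the TAXI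
   TRANSPORT `taxi R y j := Π_{i<d} leg R y j i` (legs in increasing coordinate order), `taxiT R x := taxi R (blockOf x) (digits x)`.
THE THEOREMS.
 * §2 the ONE-LEG COMMUTATION `R(p,μ)·piT R (p+e_μ) ν ℓ = (Π_{t<ℓ} plaq R (p+te_ν) μ ν)·piT R p ν ℓ·R(p+ℓe_ν, μ)` (`mul_piT_shift`) — moving a
   `μ`-bond across a `ν`-leg sweeps `ℓ` plaquettes; `‖Πz_i − 1‖ ≤ Σ‖z_i − 1‖` for `‖z_i‖ ≤ 1` (`norm_prod_sub_one_le`; the tree's `…Liouville.norm_finsetProd_le_one` sibling is not imported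
   to keep the QFT cone free of the sieve library);
 * §3 the `μ`-STEP IDENTITY `taxi R y (j + δ_μ) = hol·taxi R y j·R(L·y+j, μ)` with `hol` an explicit product of `Σ_{i>μ} j_i` plaquette
   holonomies (`taxi_succ`), hence **`inBlock_defect_taxiT_le`**:
     `j_μ + 1 < L → ‖R(L·y+j, μ)·conj (taxiT R (L·y+j+e_μ))·taxiT R (L·y+j) − 1‖ ≤ (d−1)·(L−1)·a`
   — the `hw`/`hin` binder DISCHARGED for taxi transports, k-UNIFORM (`(d−1)(L−1)a ≍ dα/(n²L)`); and `norm_taxiT` (`|taxiT| = 1`);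
 * §4 **`exists_ub_taxi`**: UB⁺'s `hUBc` (`VariationalCovariantUpperBound.exists_ub_scalarPair`) with `T := taxiT R`, whose only binders
   are `|R| = 1` and `‖plaq − 1‖ ≤ a`.
NOT here: the FACE binder (`hcross` of ONE⁺ / FED⁺'s `mis`) for a coarse transporter DERIVED from `R` (an `L × j` rectangle of plaquettes;
a sequel), colour matrices (the same identities with ordered products), anything printed.

HONEST FRAMING (T4-DAG p. 1).  A model-level DICTIONARY between two hypothesis sets of OUR leaves (site transports as data ↦ bond phases
as data); [folklore] abelian lattice gauge bookkeeping; nothing printed is a hypothesis; no `def … : Prop`; no `sorry`; axioms standard.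
NOT NE2⁺; NE2 NOT proved; spine 0/9; rung (B)+1 finite T⁴ — NOT infinite volume, NOT mass gap, NOT Clay.  HONEST DEPENDENCY (cell,
verbatim): continuum YM on T⁴ ⇐ BetaPertH ∧ nine spine estimates (0/9 proved); BetaPertH ⇐ (D1) ∧ (D4) ∧ CAP+tail; G-an2-4 gates asym,
D1 and NE2/3/4.
-/

noncomputable section

open scoped BigOperators ComplexConjugate
open Finset

namespace Summit.QuantumFields.BalabanUV.T4Continuum.VariationalTaxiTransport

open Literature.MathematicalPhysics.QuantumFieldTheory.Balaban1983to89.B5Prop11Plancherel (Tor fine unitVec)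
open Literature.MathematicalPhysics.QuantumFieldTheory.Balaban1983to89.B5Prop11Lower (nsq)
open Literature.MathematicalPhysics.QuantumFieldTheory.Balaban1983to89.B5Block118 (tstep tstep_zero tstep_succ bpt)
open Literature.MathematicalPhysics.QuantumFieldTheory.Balaban1983to89.B5Blocks16 (blockOf blockOf_bpt)
open Summit.QuantumFields.BalabanUV.T4Continuum.ScalarBlockTrialFunction (digits digits_bpt bpt_update' bpt_add_unitVec_of_lt)
open Summit.QuantumFields.BalabanUV.T4Continuum.VariationalCovariantFederbush (piT Qc dirU)
open Summit.QuantumFields.BalabanUV.T4Continuum.VariationalCovariantUpperBound (mul_conj_of_norm_one exists_ub_scalarPair)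

variable {d : ℕ}

/-! ## §1 Products of unit phases -/

section Units

/-- `‖Π z_i − 1‖ ≤ Σ ‖z_i − 1‖` when every `‖z_i‖ ≤ 1`. [folklore] -/
theorem norm_prod_sub_one_le {ι : Type*} [DecidableEq ι] (s : Finset ι) (z : ι → ℂ) (hz : ∀ i ∈ s, ‖z i‖ ≤ 1) :
    ‖∏ i ∈ s, z i - 1‖ ≤ ∑ i ∈ s, ‖z i - 1‖ := by
  induction s using Finset.induction_on with
  | empty => simp
  | insert i s hi ih =>
    rw [Finset.prod_insert hi, Finset.sum_insert hi]
    have hzi : ‖z i‖ ≤ 1 := hz i (Finset.mem_insert_self i s)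
    have ih' := ih fun k hk => hz k (Finset.mem_insert_of_mem hk)
    have e : z i * ∏ k ∈ s, z k - 1 = z i * (∏ k ∈ s, z k - 1) + (z i - 1) := by ring
    rw [e]
    refine (norm_add_le _ _).trans ?_
    rw [norm_mul]
    nlinarith [norm_nonneg (∏ k ∈ s, z k - 1), norm_nonneg (z i - 1)]

/-- a product of factors of norm `1` has norm `1`. [folklore] -/
theorem norm_prod_eq_one {ι : Type*} (s : Finset ι) (z : ι → ℂ) (hz : ∀ i ∈ s, ‖z i‖ = 1) : ‖∏ i ∈ s, z i‖ = 1 := by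
  rw [norm_prod]
  exact Finset.prod_eq_one fun i hi => hz i hi

end Units

/-! ## §2 Plaquettes, straight legs, and the one-leg commutation -/

section Legs

variable (L : ℕ) [NeZero L] (N : Fin d → ℕ) [hN : ∀ μ, NeZero (N μ)]

/-- the PLAQUETTE HOLONOMY `plaq R x μ ν = R(x,μ)·R(x+e_μ,ν)·conj R(x+e_ν,μ)·conj R(x,ν)` (U(1)). [folklore] -/
def plaq (R : Tor (fine L N) → Fin d → ℂ) (x : Tor (fine L N)) (μ ν : Fin d) : ℂ :=
  R x μ * R (x + unitVec (fine L N) μ) ν * conj (R (x + unitVec (fine L N) ν) μ) * conj (R x ν)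

variable {R : Tor (fine L N) → Fin d → ℂ} (hR1 : ∀ x μ, ‖R x μ‖ = 1)
include hR1

omit [NeZero L] hN in
/-- unit phases give unit plaquettes. [folklore] -/
theorem norm_plaq (x : Tor (fine L N)) (μ ν : Fin d) : ‖plaq L N R x μ ν‖ = 1 := by
  simp only [plaq, norm_mul, Complex.norm_conj, hR1, mul_one]

omit [NeZero L] hN in
/-- the ONE-STEP IDENTITY: `R(x,μ)·R(x+e_μ,ν) = plaq·(R(x,ν)·R(x+e_ν,μ))` for unit phases. [folklore] -/
theorem mul_eq_plaq_mul (x : Tor (fine L N)) (μ ν : Fin d) :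
    R x μ * R (x + unitVec (fine L N) μ) ν = plaq L N R x μ ν * (R x ν * R (x + unitVec (fine L N) ν) μ) := by
  have h1 := (mul_conj_of_norm_one (hR1 (x + unitVec (fine L N) ν) μ)).2
  have h2 := (mul_conj_of_norm_one (hR1 x ν)).2
  unfold plaq
  linear_combination (-(R x μ * R (x + unitVec (fine L N) μ) ν)) * h1
    + (-(R x μ * R (x + unitVec (fine L N) μ) ν * (conj (R (x + unitVec (fine L N) ν) μ) * R (x + unitVec (fine L N) ν) μ))) * h2

omit [NeZero L] hN in
/-- straight legs of unit phases have norm `1`. [folklore] -/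
theorem norm_piT (x : Tor (fine L N)) (μ : Fin d) (t : ℕ) : ‖piT L N R x μ t‖ = 1 := by
  induction t with
  | zero => simp [piT]
  | succ t ih => simp only [piT, norm_mul, ih, hR1, mul_one]

omit [NeZero L] hN in
/-- **ONE-LEG COMMUTATION**: moving a `μ`-bond across a straight `ν`-leg of length `ℓ` sweeps `ℓ` plaquettes:
`R(p,μ)·piT R (p+e_μ) ν ℓ = (Π_{t<ℓ} plaq R (p + t e_ν) μ ν)·(piT R p ν ℓ·R(p + ℓ e_ν, μ))`. [folklore] -/
theorem mul_piT_shift (p : Tor (fine L N)) (μ ν : Fin d) (ℓ : ℕ) :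
    R p μ * piT L N R (p + unitVec (fine L N) μ) ν ℓ
      = (∏ t ∈ Finset.range ℓ, plaq L N R (p + tstep (fine L N) ν t) μ ν)
          * (piT L N R p ν ℓ * R (p + tstep (fine L N) ν ℓ) μ) := by
  induction ℓ with
  | zero => simp [piT, tstep_zero]
  | succ ℓ ih =>
    have hq : p + unitVec (fine L N) μ + tstep (fine L N) ν ℓ = p + tstep (fine L N) ν ℓ + unitVec (fine L N) μ := add_right_comm _ _ _
    have hs : p + tstep (fine L N) ν ℓ + unitVec (fine L N) ν = p + tstep (fine L N) ν (ℓ + 1) := by rw [tstep_succ, add_assoc]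
    calc R p μ * piT L N R (p + unitVec (fine L N) μ) ν (ℓ + 1)
        = (R p μ * piT L N R (p + unitVec (fine L N) μ) ν ℓ) * R (p + tstep (fine L N) ν ℓ + unitVec (fine L N) μ) ν := by
          simp only [piT, hq]; ring
      _ = (∏ t ∈ Finset.range ℓ, plaq L N R (p + tstep (fine L N) ν t) μ ν) * piT L N R p ν ℓ
            * (R (p + tstep (fine L N) ν ℓ) μ * R (p + tstep (fine L N) ν ℓ + unitVec (fine L N) μ) ν) := by rw [ih]; ring
      _ = (∏ t ∈ Finset.range ℓ, plaq L N R (p + tstep (fine L N) ν t) μ ν) * piT L N R p ν ℓ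
            * (plaq L N R (p + tstep (fine L N) ν ℓ) μ ν
              * (R (p + tstep (fine L N) ν ℓ) ν * R (p + tstep (fine L N) ν (ℓ + 1)) μ)) := by
          rw [mul_eq_plaq_mul L N hR1, hs]
      _ = (∏ t ∈ Finset.range (ℓ + 1), plaq L N R (p + tstep (fine L N) ν t) μ ν)
            * (piT L N R p ν (ℓ + 1) * R (p + tstep (fine L N) ν (ℓ + 1)) μ) := by
          rw [Finset.prod_range_succ]; simp only [piT]; ring

end Legs

/-! ## §3 The taxi transport and its `μ`-step identity -/

section Taxi

variable (L : ℕ) [NeZero L] (N : Fin d → ℕ) [hN : ∀ μ, NeZero (N μ)]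

/-- the digits switched on below `i`: `(j_κ for κ < i, 0 else)`. [folklore] -/
def below (j : Fin d → Fin L) (i : ℕ) : Fin d → Fin L := fun κ => if (κ : ℕ) < i then j κ else 0

/-- the CORNER of the taxi path after the legs in the directions `< i`. [folklore] -/
def corner (y : Tor N) (j : Fin d → Fin L) (i : ℕ) : Tor (fine L N) := bpt L N y (below L j i)

/-- the `i`-th LEG: the straight transport from the `i`-th corner, `j_i` steps in direction `i` (and `1` beyond `d`). [folklore] -/
def leg (R : Tor (fine L N) → Fin d → ℂ) (y : Tor N) (j : Fin d → Fin L) (i : ℕ) : ℂ :=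
  if h : i < d then piT L N R (corner L N y j i) ⟨i, h⟩ (j ⟨i, h⟩ : ℕ) else 1

/-- **THE TAXI TRANSPORT** from the block base point `L·y` to `L·y + j`, legs in increasing coordinate order. [folklore] -/
def taxi (R : Tor (fine L N) → Fin d → ℂ) (y : Tor N) (j : Fin d → Fin L) : ℂ := ∏ i ∈ Finset.range d, leg L N R y j i

/-- the taxi transport as a function on the fine torus (block and digits of the site). [folklore] -/
def taxiT (R : Tor (fine L N) → Fin d → ℂ) (x : Tor (fine L N)) : ℂ := taxi L N R (blockOf L N x) (digits L N x)

/-- `taxiT` at a block point. [folklore] -/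
theorem taxiT_bpt (R : Tor (fine L N) → Fin d → ℂ) (y : Tor N) (j : Fin d → Fin L) :
    taxiT L N R (bpt L N y j) = taxi L N R y j := by
  rw [taxiT, blockOf_bpt, digits_bpt]

omit hN in
/-- all digits on: `below j d = j`; none on: `below j 0 = 0`. [folklore] -/
theorem below_d (j : Fin d → Fin L) : below L j d = j := by
  funext κ; simp [below, κ.is_lt]

omit hN in
/-- switching on the `i`-th digit. [folklore] -/
theorem below_succ (j : Fin d → Fin L) {i : ℕ} (hi : i < d) :
    below L j (i + 1) = Function.update (below L j i) ⟨i, hi⟩ (j ⟨i, hi⟩) := by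
  funext κ
  simp only [below, Function.update_apply]
  by_cases h : κ = ⟨i, hi⟩
  · subst h; simp
  · have hκ : (κ : ℕ) ≠ i := fun e => h (Fin.ext e)
    have : ((κ : ℕ) < i + 1) ↔ ((κ : ℕ) < i) := by omega
    simp [h, this]

omit hN in
/-- beyond `d` nothing changes. [folklore] -/
theorem below_of_le (j : Fin d → Fin L) {i : ℕ} (hi : d ≤ i) : below L j i = j := by
  funext κ; have := κ.is_lt; simp [below, show (κ : ℕ) < i by omega]

omit hN in
/-- the corner steps: `corner (i+1) = corner i + j_i e_i` for `i < d`. [folklore] -/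
theorem corner_succ (y : Tor N) (j : Fin d → Fin L) {i : ℕ} (hi : i < d) :
    corner L N y j (i + 1) = corner L N y j i + tstep (fine L N) ⟨i, hi⟩ (j ⟨i, hi⟩ : ℕ) := by
  have h0 : (below L j i) ⟨i, hi⟩ = 0 := by simp [below]
  have hupd : Function.update (below L j i) ⟨i, hi⟩ 0 = below L j i := by
    rw [← h0, Function.update_eq_self]
  rw [corner, corner, below_succ L j hi, bpt_update', hupd]

omit hN in
/-- the last corner is the site itself. [folklore] -/
theorem corner_d (y : Tor N) (j : Fin d → Fin L) : corner L N y j d = bpt L N y j := by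
  rw [corner, below_d]

variable {R : Tor (fine L N) → Fin d → ℂ} (hR1 : ∀ x μ, ‖R x μ‖ = 1)
include hR1

omit hN in
/-- legs have norm `1`. [folklore] -/
theorem norm_leg (y : Tor N) (j : Fin d → Fin L) (i : ℕ) : ‖leg L N R y j i‖ = 1 := by
  unfold leg
  split_ifs with h
  · exact norm_piT L N hR1 _ _ _
  · exact norm_one

omit hN in
/-- `|taxi| = 1`. [folklore] -/
theorem norm_taxi (y : Tor N) (j : Fin d → Fin L) : ‖taxi L N R y j‖ = 1 :=
  norm_prod_eq_one _ _ fun i _ => norm_leg L N hR1 y j i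

/-- `|taxiT| = 1` — the unit-transport binder of UB⁺ / ONE⁺ for taxi transports. [folklore] -/
theorem norm_taxiT (x : Tor (fine L N)) : ‖taxiT L N R x‖ = 1 := norm_taxi L N hR1 _ _

omit hN hR1 in
/-- the `μ`-step leaves the corners up to `μ` alone and shifts the later ones by `e_μ`. [folklore] -/
theorem corner_update (y : Tor N) (j : Fin d → Fin L) (μ : Fin d) (h : (j μ : ℕ) + 1 < L) (i : ℕ) :
    corner L N y (Function.update j μ ⟨(j μ : ℕ) + 1, h⟩) i
      = if (μ : ℕ) < i then corner L N y j i + unitVec (fine L N) μ else corner L N y j i := by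
  split_ifs with hμ
  · have hbelow : below L (Function.update j μ ⟨(j μ : ℕ) + 1, h⟩) i
        = Function.update (below L j i) μ ⟨((below L j i) μ : ℕ) + 1, by simp [below, hμ, h]⟩ := by
      funext κ
      simp only [below, Function.update_apply]
      by_cases hκ : κ = μ
      · subst hκ; simp [hμ]
      · simp [hκ]
    rw [corner, corner, hbelow, ← bpt_add_unitVec_of_lt]
  · have hbelow : below L (Function.update j μ ⟨(j μ : ℕ) + 1, h⟩) i = below L j i := by
      funext κ
      simp only [below, Function.update_apply]
      by_cases hκ : κ = μ
      · subst hκ; simp [hμ]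
      · simp [hκ]
    rw [corner, corner, hbelow]

/-- the explicit holonomy of the `μ`-step: the plaquettes swept by the legs after `μ`. [folklore] -/
def hol (R : Tor (fine L N) → Fin d → ℂ) (y : Tor N) (j : Fin d → Fin L) (μ : Fin d) : ℂ :=
  ∏ i ∈ Finset.Ico ((μ : ℕ) + 1) d,
    if h : i < d then ∏ t ∈ Finset.range (j ⟨i, h⟩ : ℕ), plaq L N R (corner L N y j i + tstep (fine L N) ⟨i, h⟩ t) μ ⟨i, h⟩ else 1

omit hN in
/-- the holonomy is within `a·Σ_{i>μ} j_i ≤ (d−1)(L−1)·a` of `1` under the plaquette defect `a`. [folklore] -/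
theorem norm_hol_sub_one_le (y : Tor N) (j : Fin d → Fin L) (μ : Fin d) {a : ℝ} (ha : ∀ x κ ν, ‖plaq L N R x κ ν - 1‖ ≤ a) :
    ‖hol L N R y j μ - 1‖ ≤ ((d - 1 : ℕ) : ℝ) * ((L - 1 : ℕ) : ℝ) * a := by
  have ha0 : 0 ≤ a := (norm_nonneg _).trans (ha (corner L N y j 0) μ μ)
  unfold hol
  refine (norm_prod_sub_one_le _ _ fun i _ => ?_).trans ?_
  · split_ifs with h
    · rw [norm_prod]; exact Finset.prod_le_one (fun _ _ => norm_nonneg _) fun t _ => (norm_plaq L N hR1 _ _ _).le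
    · simp
  · have hterm : ∀ i ∈ Finset.Ico ((μ : ℕ) + 1) d,
        ‖(if h : i < d then ∏ t ∈ Finset.range (j ⟨i, h⟩ : ℕ), plaq L N R (corner L N y j i + tstep (fine L N) ⟨i, h⟩ t) μ ⟨i, h⟩
            else 1) - 1‖ ≤ ((L - 1 : ℕ) : ℝ) * a := by
      intro i hi
      have h : i < d := (Finset.mem_Ico.mp hi).2
      rw [dif_pos h]
      refine (norm_prod_sub_one_le _ _ fun t _ => (norm_plaq L N hR1 _ _ _).le).trans ?_
      refine (Finset.sum_le_sum fun t _ => ha _ _ _).trans ?_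
      rw [Finset.sum_const, Finset.card_range, nsmul_eq_mul]
      have hj : ((j ⟨i, h⟩ : ℕ) : ℝ) ≤ ((L - 1 : ℕ) : ℝ) := by exact_mod_cast Nat.le_sub_one_of_lt (j ⟨i, h⟩).is_lt
      exact mul_le_mul_of_nonneg_right hj ha0
    refine (Finset.sum_le_sum hterm).trans ?_
    rw [Finset.sum_const, Nat.card_Ico, nsmul_eq_mul]
    have hcard : ((d - ((μ : ℕ) + 1) : ℕ) : ℝ) ≤ ((d - 1 : ℕ) : ℝ) := by
      exact_mod_cast Nat.sub_le_sub_left (Nat.le_add_left 1 (μ : ℕ)) d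
    have : 0 ≤ ((L - 1 : ℕ) : ℝ) * a := mul_nonneg (Nat.cast_nonneg _) ha0
    nlinarith

omit hN in
/-- **THE `μ`-STEP IDENTITY**: `taxi R y (j + δ_μ) = hol·(taxi R y j·R(L·y + j, μ))`. [folklore] -/
theorem taxi_succ (y : Tor N) (j : Fin d → Fin L) (μ : Fin d) (h : (j μ : ℕ) + 1 < L) :
    taxi L N R y (Function.update j μ ⟨(j μ : ℕ) + 1, h⟩) = hol L N R y j μ * (taxi L N R y j * R (bpt L N y j) μ) := by
  set j' := Function.update j μ ⟨(j μ : ℕ) + 1, h⟩ with hj'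
  have hμd : (μ : ℕ) < d := μ.is_lt
  -- the legs: unchanged below μ, one more bond at μ, shifted start above μ
  have hleg_lt : ∀ i, i < (μ : ℕ) → leg L N R y j' i = leg L N R y j i := by
    intro i hi
    have hid : i < d := hi.trans hμd
    have hne : (⟨i, hid⟩ : Fin d) ≠ μ := fun e => by have := congrArg Fin.val e; simp at this; omega
    simp only [leg, dif_pos hid, corner_update L N y j μ h i, if_neg (not_lt.mpr hi.le), hj', Function.update_of_ne hne]
  have hleg_eq : leg L N R y j' μ = leg L N R y j μ * R (corner L N y j ((μ : ℕ) + 1)) μ := by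
    have hc : corner L N y j' μ = corner L N y j μ := by
      rw [hj', corner_update L N y j μ h μ, if_neg (lt_irrefl _)]
    have hjμ : (j' μ : ℕ) = (j μ : ℕ) + 1 := by simp [hj']
    simp only [leg, dif_pos hμd, Fin.eta, hc, hjμ, corner_succ L N y j hμd, piT]
  have hleg_gt : ∀ i, (μ : ℕ) < i → (hi : i < d) →
      leg L N R y j' i = piT L N R (corner L N y j i + unitVec (fine L N) μ) ⟨i, hi⟩ (j ⟨i, hi⟩ : ℕ) := by
    intro i hμi hid
    have hne : (⟨i, hid⟩ : Fin d) ≠ μ := fun e => by have := congrArg Fin.val e; simp at this; omega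
    simp only [leg, dif_pos hid, corner_update L N y j μ h i, if_pos hμi, hj', Function.update_of_ne hne]
  -- moving the new μ-bond across the later legs, one leg at a time
  have sweep : ∀ k, (μ : ℕ) + 1 ≤ k → k ≤ d →
      R (corner L N y j ((μ : ℕ) + 1)) μ * ∏ i ∈ Finset.Ico ((μ : ℕ) + 1) k, leg L N R y j' i
        = (∏ i ∈ Finset.Ico ((μ : ℕ) + 1) k,
            if h : i < d then ∏ t ∈ Finset.range (j ⟨i, h⟩ : ℕ), plaq L N R (corner L N y j i + tstep (fine L N) ⟨i, h⟩ t) μ ⟨i, h⟩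
            else 1)
          * ((∏ i ∈ Finset.Ico ((μ : ℕ) + 1) k, leg L N R y j i) * R (corner L N y j k) μ) := by
    intro k hk hkd
    induction k, hk using Nat.le_induction with
    | base => simp
    | succ k hk ih =>
      have hkd' : k < d := Nat.lt_of_succ_le hkd
      rw [Finset.prod_Ico_succ_top hk, Finset.prod_Ico_succ_top hk, Finset.prod_Ico_succ_top hk, ← mul_assoc, ih hkd'.le,
        hleg_gt k (Nat.lt_of_succ_le hk) hkd', dif_pos hkd']
      rw [show leg L N R y j k = piT L N R (corner L N y j k) ⟨k, hkd'⟩ (j ⟨k, hkd'⟩ : ℕ) by simp [leg, dif_pos hkd'],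
        corner_succ L N y j hkd']
      have hc := mul_piT_shift L N hR1 (corner L N y j k) μ ⟨k, hkd'⟩ (j ⟨k, hkd'⟩ : ℕ)
      calc (∏ i ∈ Finset.Ico ((μ : ℕ) + 1) k, if h : i < d then
              ∏ t ∈ Finset.range (j ⟨i, h⟩ : ℕ), plaq L N R (corner L N y j i + tstep (fine L N) ⟨i, h⟩ t) μ ⟨i, h⟩ else 1)
            * ((∏ i ∈ Finset.Ico ((μ : ℕ) + 1) k, leg L N R y j i) * R (corner L N y j k) μ)
            * piT L N R (corner L N y j k + unitVec (fine L N) μ) ⟨k, hkd'⟩ (j ⟨k, hkd'⟩ : ℕ)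
          = (∏ i ∈ Finset.Ico ((μ : ℕ) + 1) k, if h : i < d then
              ∏ t ∈ Finset.range (j ⟨i, h⟩ : ℕ), plaq L N R (corner L N y j i + tstep (fine L N) ⟨i, h⟩ t) μ ⟨i, h⟩ else 1)
            * (∏ i ∈ Finset.Ico ((μ : ℕ) + 1) k, leg L N R y j i)
            * (R (corner L N y j k) μ * piT L N R (corner L N y j k + unitVec (fine L N) μ) ⟨k, hkd'⟩ (j ⟨k, hkd'⟩ : ℕ)) := by ring
        _ = _ := by rw [hc]; ring
  -- assemble: split the leg product at μ and at μ+1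
  have hsplit : ∀ g : ℕ → ℂ, ∏ i ∈ Finset.range d, g i
      = (∏ i ∈ Finset.range (μ : ℕ), g i) * g μ * ∏ i ∈ Finset.Ico ((μ : ℕ) + 1) d, g i := by
    intro g
    rw [Finset.range_eq_Ico, ← Finset.prod_Ico_consecutive g (Nat.zero_le _) hμd.le,
      Finset.prod_eq_prod_Ico_succ_bot hμd, Finset.range_eq_Ico]
    ring
  have hsw := sweep d (Nat.succ_le_of_lt hμd) le_rfl
  rw [corner_d] at hsw
  unfold taxi hol
  rw [hsplit, hsplit (leg L N R y j), Finset.prod_congr rfl fun i hi => hleg_lt i (Finset.mem_range.mp hi), hleg_eq]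
  calc (∏ i ∈ Finset.range (μ : ℕ), leg L N R y j i) * (leg L N R y j μ * R (corner L N y j ((μ : ℕ) + 1)) μ)
        * ∏ i ∈ Finset.Ico ((μ : ℕ) + 1) d, leg L N R y j' i
      = (∏ i ∈ Finset.range (μ : ℕ), leg L N R y j i) * leg L N R y j μ
        * (R (corner L N y j ((μ : ℕ) + 1)) μ * ∏ i ∈ Finset.Ico ((μ : ℕ) + 1) d, leg L N R y j' i) := by ring
    _ = _ := by rw [hsw]; ring

/-- **THE IN-BLOCK TRANSPORT DEFECT OF TAXI TRANSPORTS** — the `hw` binder of UB⁺ (`VariationalCovariantUpperBound`) / the `hin` binder of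
ONE⁺ (`VariationalCovariantInterpolant`) DISCHARGED from the plaquette defect alone:
`j_μ + 1 < L → ‖R(L·y+j, μ)·conj (taxiT R (L·y+j+e_μ))·taxiT R (L·y+j) − 1‖ ≤ (d−1)·(L−1)·a`. [folklore] -/
theorem inBlock_defect_taxiT_le {a : ℝ} (ha : ∀ x κ ν, ‖plaq L N R x κ ν - 1‖ ≤ a)
    (y : Tor N) (j : Fin d → Fin L) (μ : Fin d) (h : (j μ : ℕ) + 1 < L) :
    ‖R (bpt L N y j) μ * conj (taxiT L N R (bpt L N y j + unitVec (fine L N) μ)) * taxiT L N R (bpt L N y j) - 1‖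
      ≤ ((d - 1 : ℕ) : ℝ) * ((L - 1 : ℕ) : ℝ) * a := by
  rw [bpt_add_unitVec_of_lt L N y j μ h, taxiT_bpt, taxiT_bpt, taxi_succ L N hR1 y j μ h]
  have hT := (mul_conj_of_norm_one (norm_taxi L N hR1 y j)).2
  have hRc := (mul_conj_of_norm_one (hR1 (bpt L N y j) μ)).1
  have e : R (bpt L N y j) μ * conj (hol L N R y j μ * (taxi L N R y j * R (bpt L N y j) μ)) * taxi L N R y j - 1
      = conj (hol L N R y j μ - 1) := by
    simp only [map_mul, map_sub, map_one]
    linear_combination (conj (hol L N R y j μ) * conj (taxi L N R y j) * taxi L N R y j) * hRc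
      + conj (hol L N R y j μ) * hT
  rw [e, Complex.norm_conj]
  exact norm_hol_sub_one_le L N hR1 y j μ ha

/-! ## §4 UB⁺ for taxi transports: binders `|R| = 1` and the plaquette defect only -/

/-- **UB⁺ WITH TAXI TRANSPORTS**: `VariationalCovariantUpperBound.exists_ub_scalarPair` at `T := taxiT R` — for every unit-lattice `φ` a
competitor with `Q_T f = φ` exactly and `n²/n^d·Σ_μ dirU R f μ ≤ 2d·36^d·((1 + n·(d−1)(n−1)·a)² + 9)·Σ|φ|²` (here the fine torus is
`Tor (fine n M)` over the unit torus, `a ≥ 0` its plaquette defect: `n·(d−1)(n−1)·a ≍ dα` for `a ≍ α n⁻²` — k-UNIFORM); the only binders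
are `|R| = 1` and `‖plaq − 1‖ ≤ a`. [folklore] -/
theorem exists_ub_taxi {a : ℝ} (ha0 : 0 ≤ a) (ha : ∀ x κ ν, ‖plaq L N R x κ ν - 1‖ ≤ a) :
    ∀ φ : Tor N → ℂ, ∃ f : Tor (fine L N) → ℂ, (fun z => Qc L N (taxiT L N R) f z) = φ ∧
      (L : ℝ) ^ 2 / (L : ℝ) ^ d * ∑ μ, dirU (fine L N) R f μ
        ≤ 2 * d * (36 : ℝ) ^ d * ((1 + L * (((d - 1 : ℕ) : ℝ) * ((L - 1 : ℕ) : ℝ) * a)) ^ 2 + 9) * nsq φ :=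
  exists_ub_scalarPair L N (norm_taxiT L N hR1) (fun x μ => (hR1 x μ).le)
    (mul_nonneg (mul_nonneg (Nat.cast_nonneg _) (Nat.cast_nonneg _)) ha0)
    (fun y j μ h => inBlock_defect_taxiT_le L N hR1 ha y j μ h)

end Taxi

end Summit.QuantumFields.BalabanUV.T4Continuum.VariationalTaxiTransport

end
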